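import Summits.QuantumAdvantage.QuantumAdvantage.Theorems.LivenessSeparationLawJ

set_option linter.dupNamespace false

/-!
# LIVENESS SEPARATION, part P (lens 4, g28 cycle 4e) — PRESCRIBED LIVENESS PATTERNS (Lemma D with a chosen live set)

Blocker `X = AbsorptionDial.NoPerfectPolyOdd` (item 28487).  Part N (`livenessDesign`) makes ONE cut — chosen by the lemma — live and the other cuts of
a 2-separated chain dead.  The sequential form of «SeparatedQuadNoPerfectOdd» (NODE-g28 §5h) needs the live set PRESCRIBED: this part runs the
move formulation of part N with an arbitrary residue pattern `R : cuts → {0,1,2}` (`xPattern`, `walk_residue_gapPattern`): under the single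
congruence `(★)  c + 2x₀ + xl + 2 g₀ + 2 g_{T-1} + R(T-1) + 2(3 - R 0) ≡ 0 (mod 3)` the gap design realises `R` exactly, i.e. cut `l` is live iff
`R l ≠ 0` (★ `livenessPattern`).  Corollaries with explicit solutions of `(★)`: a prescribed cut alone (`livenessDesign_at`; the first / last cut
`isolate_first` / `isolate_last` unless the ends pair `{0,n}` with `n ≡ c`; a middle cut `isolate_middle` given end capacity or `E ≡ 0`), a middle
cut together with at most the last / the first cut (`isolate_middle_last` / `isolate_middle_first`, ALWAYS), and both end cuts with every
middle cut dead (`isolate_ends`, ALWAYS).  Brute force (n ≤ 9, every c, every 2-separated chain) confirms that `(★)`-solvability is also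
necessary for these patterns.  A last section records the class bookkeeping for SCATTERED one-sided free sets (`liveCut_fill_oneSided`: part J's
`liveCut_fill_block_outside` without the interval hypothesis).
-/

open Finset
open Summit.QuantumAdvantage.AdviceFreeQNC0
open Summit.QuantumAdvantage.QuantumAdvantage.Theorems.InnerDegreeDial

namespace Summit.QuantumAdvantage.QuantumAdvantage.Theorems.LivenessSeparation

variable {n : ℕ}

section Pattern

variable {T : ℕ} {g : ℕ → ℕ}

/-- the gap fillings realising a residue pattern `R`: `x j ≡ R (j+1) - R j - (g (j+1) - g j)` between cuts, `xl` after the last cut -/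
def xPattern (T : ℕ) (g : ℕ → ℕ) (R : ℕ → ℕ) (xl j : ℕ) : ℕ :=
  if j + 1 < T then (R (j + 1) + (3 - R j) + (3 - (g (j + 1) - g j) % 3)) % 3 else xl

/-- fillings are at most 2 -/
theorem xPattern_le {R : ℕ → ℕ} {xl : ℕ} (hxl : xl ≤ 2) (j : ℕ) : xPattern T g R xl j ≤ 2 := by
  unfold xPattern
  split_ifs <;> omega

/-- the last filling -/
theorem xPattern_last {R : ℕ → ℕ} {xl j : ℕ} (hj : j + 1 = T) : xPattern T g R xl j = xl := by
  unfold xPattern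
  rw [if_neg (by omega)]

/-- the designed residues: `g l + Σ_{j<l} x j ≡ g 0 + R l - R 0 (mod 3)` -/
theorem residue_xPattern (hsep : ∀ j, j + 1 < T → g j + 2 ≤ g (j + 1)) {R : ℕ → ℕ} {xl : ℕ} (hR : ∀ j, R j ≤ 2) {l : ℕ}
    (hl : l < T) : (g l + ∑ j ∈ range l, xPattern T g R xl j) % 3 = (g 0 + R l + (3 - R 0)) % 3 := by
  induction l with
  | zero =>
    have := hR 0
    rw [sum_range_zero]
    omega
  | succ k ih =>
    have hk : k < T := by omega
    have h1 := ih hk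
    have h2 : xPattern T g R xl k = (R (k + 1) + (3 - R k) + (3 - (g (k + 1) - g k) % 3)) % 3 := by
      unfold xPattern
      rw [if_pos hl]
    have h3 := hsep k hl
    have h4 := hR k
    have h5 := hR (k + 1)
    have h6 := hR 0
    rw [sum_range_succ, h2]
    omega

/-- THE WALK RESIDUES OF THE PATTERN DESIGN: under `(★)` cut `l` has walk residue `c + g l + walkExp ≡ R l`. -/
theorem walk_residue_gapPattern (hsep : ∀ j, j + 1 < T → g j + 2 ≤ g (j + 1)) (hT : 1 ≤ T) (hgn : g (T - 1) ≤ n)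
    {c x₀ xl : ℕ} {R : ℕ → ℕ} (hR : ∀ j, R j ≤ 2) (hx₀ : x₀ ≤ g 0) (hxl2 : xl ≤ 2) (hxln : g (T - 1) + xl ≤ n)
    (hstar : (c + 2 * x₀ + xl + 2 * g 0 + 2 * g (T - 1) + R (T - 1) + 2 * (3 - R 0)) % 3 = 0)
    {l : ℕ} (hl : l < T) :
    (c + g l + walkExp (gapDesign n T g x₀ (xPattern T g R xl)) (g l)) % 3 = R l % 3 := by
  obtain ⟨T', rfl⟩ : ∃ T', T = T' + 1 := ⟨T - 1, by omega⟩
  have hx : ∀ j < T' + 1, xPattern (T' + 1) g R xl j ≤ 2 := fun j _ => xPattern_le hxl2 j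
  have hxn : g (T' + 1 - 1) + xPattern (T' + 1) g R xl (T' + 1 - 1) ≤ n := by
    rw [Nat.add_sub_cancel, xPattern_last rfl]
    simpa using hxln
  rw [walkExp_gapDesign hsep hT hgn hx₀ hx hxn hl, sum_range_succ, xPattern_last rfl]
  have r1 := residue_xPattern hsep (xl := xl) hR hl
  have r2 := residue_xPattern hsep (xl := xl) hR (show T' < T' + 1 by omega)
  simp only [Nat.add_sub_cancel] at hstar
  have h4 := hR l
  have h5 := hR T'
  have h6 := hR 0
  omega

/-- liveness of the pattern design at cut `l`: live iff `R l ≠ 0` -/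
theorem gapPattern_liveCut (hsep : ∀ j, j + 1 < T → g j + 2 ≤ g (j + 1)) (hT : 1 ≤ T) (hgn : g (T - 1) ≤ n)
    {c x₀ xl : ℕ} {R : ℕ → ℕ} (hR : ∀ j, R j ≤ 2) (hx₀ : x₀ ≤ g 0) (hxl2 : xl ≤ 2) (hxln : g (T - 1) + xl ≤ n)
    (hstar : (c + 2 * x₀ + xl + 2 * g 0 + 2 * g (T - 1) + R (T - 1) + 2 * (3 - R 0)) % 3 = 0)
    {l : ℕ} (hl : l < T) (gl : Fin (n + 1)) (hgl : gl.val = g l) :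
    liveCut c (gapDesign n T g x₀ (xPattern T g R xl)) gl = decide (R l ≠ 0) := by
  have h := walk_residue_gapPattern (n := n) hsep hT hgn (c := c) (x₀ := x₀) hR hx₀ hxl2 hxln hstar hl
  have hRl := hR l
  unfold liveCut
  rw [hgl]
  by_cases h0 : R l = 0
  · rw [h0] at h
    rw [h0, decide_eq_false (fun h' : (0 : ℕ) ≠ 0 => h' rfl), decide_eq_false_iff_not]
    omega
  · rw [decide_eq_true h0, decide_eq_true_eq]
    omega

/-- **PRESCRIBED LIVENESS PATTERN (Lemma D with a chosen live set).**  `T ≥ 1` cuts `g 0 < ⋯ < g (T-1) ≤ n` pairwise `≥ 2` apart, a residue pattern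
`R` (values `≤ 2`), `x₀ ≤ g 0` ones before the first cut and `xl ≤ 2` (fitting) ones after the last one with `(★)`: some input makes cut `l` live
exactly when `R l ≠ 0`. -/
theorem livenessPattern (hsep : ∀ j, j + 1 < T → g j + 2 ≤ g (j + 1)) (hT : 1 ≤ T) (hgn : g (T - 1) ≤ n)
    {c x₀ xl : ℕ} {R : ℕ → ℕ} (hR : ∀ j, R j ≤ 2) (hx₀ : x₀ ≤ g 0) (hxl2 : xl ≤ 2) (hxln : g (T - 1) + xl ≤ n)
    (hstar : (c + 2 * x₀ + xl + 2 * g 0 + 2 * g (T - 1) + R (T - 1) + 2 * (3 - R 0)) % 3 = 0) :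
    ∃ u : Fin n → Bool, ∀ l < T, ∀ gl : Fin (n + 1), gl.val = g l → liveCut c u gl = decide (R l ≠ 0) :=
  ⟨gapDesign n T g x₀ (xPattern T g R xl), fun _ hl gl hgl => gapPattern_liveCut hsep hT hgn hR hx₀ hxl2 hxln hstar hl gl hgl⟩

end Pattern

/-! ### explicit solutions of `(★)` -/

section Corollaries

variable {T : ℕ} {g : ℕ → ℕ}

/-- the single target at its own cut -/
theorem tgt_self (j₀ r : ℕ) : tgt j₀ r j₀ = r := by
  unfold tgt
  rw [if_pos rfl]

/-- the single target away from its cut -/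
theorem tgt_of_ne {j₀ j : ℕ} (r : ℕ) (h : j ≠ j₀) : tgt j₀ r j = 0 := by
  unfold tgt
  rw [if_neg h]

/-- a PRESCRIBED cut alone: any admissible `(r, x₀, xl)` for `(★)` makes cut `j₀` live and every other cut dead (part N's `livenessDesign_of`
with the live cut named) -/
theorem livenessDesign_at (hsep : ∀ j, j + 1 < T → g j + 2 ≤ g (j + 1)) (hT : 1 ≤ T) (hgn : g (T - 1) ≤ n)
    {c j₀ r x₀ xl : ℕ} (hj₀ : j₀ < T) (hr : r = 1 ∨ r = 2) (hx₀ : x₀ ≤ g 0) (hxl2 : xl ≤ 2) (hxln : g (T - 1) + xl ≤ n)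
    (hstar : (c + 2 * x₀ + xl + 2 * g 0 + 2 * g (T - 1) + tgt j₀ r (T - 1) + 2 * (3 - tgt j₀ r 0)) % 3 = 0) :
    ∃ u : Fin n → Bool, (∀ gl : Fin (n + 1), gl.val = g j₀ → liveCut c u gl = true) ∧
      ∀ l < T, l ≠ j₀ → ∀ gl : Fin (n + 1), gl.val = g l → liveCut c u gl = false :=
  ⟨gapDesign n T g x₀ (xDesign T g j₀ r xl), fun gl hgl => gapDesign_live hsep hT hgn hr hx₀ hxl2 hxln hstar hj₀ gl hgl,
    fun _ hl hlj gl hgl => gapDesign_dead hsep hT hgn hr hx₀ hxl2 hxln hstar hl hlj gl hgl⟩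

/-- THE FIRST CUT ALONE (`T ≥ 2`): possible unless the first cut is at `0`, the last at `n` and `c + 2 g₀ + 2 g_{T-1} ≡ 0` (for the ends pair
`{0, n}` this is `n ≡ c`, cf. `coLive_ends`). -/
theorem isolate_first (hsep : ∀ j, j + 1 < T → g j + 2 ≤ g (j + 1)) (hT : 2 ≤ T) (hgn : g (T - 1) ≤ n) (c : ℕ)
    (h : 1 ≤ g 0 ∨ g (T - 1) + 1 ≤ n ∨ (c + 2 * g 0 + 2 * g (T - 1)) % 3 ≠ 0) :
    ∃ u : Fin n → Bool, (∀ gl : Fin (n + 1), gl.val = g 0 → liveCut c u gl = true) ∧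
      ∀ l < T, l ≠ 0 → ∀ gl : Fin (n + 1), gl.val = g l → liveCut c u gl = false := by
  have e1 : ∀ r, tgt 0 r (T - 1) = 0 := fun r => tgt_of_ne r (by omega)
  have e2 : ∀ r, tgt 0 r 0 = r := fun r => tgt_self 0 r
  have hE : (c + 2 * g 0 + 2 * g (T - 1)) % 3 = 0 ∨ (c + 2 * g 0 + 2 * g (T - 1)) % 3 = 1 ∨
      (c + 2 * g 0 + 2 * g (T - 1)) % 3 = 2 := by omega
  rcases hE with hE | hE | hE
  · rcases h with h | h | h
    · exact livenessDesign_at hsep (by omega) hgn (j₀ := 0) (r := 1) (x₀ := 1) (xl := 0) (by omega) (Or.inl rfl) h (by omega)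
        (by omega) (by rw [e1, e2]; omega)
    · exact livenessDesign_at hsep (by omega) hgn (j₀ := 0) (r := 2) (x₀ := 0) (xl := 1) (by omega) (Or.inr rfl) (by omega)
        (by omega) h (by rw [e1, e2]; omega)
    · exact absurd hE h
  · exact livenessDesign_at hsep (by omega) hgn (j₀ := 0) (r := 2) (x₀ := 0) (xl := 0) (by omega) (Or.inr rfl) (by omega)
      (by omega) (by omega) (by rw [e1, e2]; omega)
  · exact livenessDesign_at hsep (by omega) hgn (j₀ := 0) (r := 1) (x₀ := 0) (xl := 0) (by omega) (Or.inl rfl) (by omega)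
      (by omega) (by omega) (by rw [e1, e2]; omega)

/-- THE LAST CUT ALONE (`T ≥ 2`), under the same condition. -/
theorem isolate_last (hsep : ∀ j, j + 1 < T → g j + 2 ≤ g (j + 1)) (hT : 2 ≤ T) (hgn : g (T - 1) ≤ n) (c : ℕ)
    (h : 1 ≤ g 0 ∨ g (T - 1) + 1 ≤ n ∨ (c + 2 * g 0 + 2 * g (T - 1)) % 3 ≠ 0) :
    ∃ u : Fin n → Bool, (∀ gl : Fin (n + 1), gl.val = g (T - 1) → liveCut c u gl = true) ∧
      ∀ l < T, l ≠ T - 1 → ∀ gl : Fin (n + 1), gl.val = g l → liveCut c u gl = false := by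
  have e1 : ∀ r, tgt (T - 1) r (T - 1) = r := fun r => tgt_self (T - 1) r
  have e2 : ∀ r, tgt (T - 1) r 0 = 0 := fun r => tgt_of_ne r (by omega)
  have hE : (c + 2 * g 0 + 2 * g (T - 1)) % 3 = 0 ∨ (c + 2 * g 0 + 2 * g (T - 1)) % 3 = 1 ∨
      (c + 2 * g 0 + 2 * g (T - 1)) % 3 = 2 := by omega
  rcases hE with hE | hE | hE
  · rcases h with h | h | h
    · exact livenessDesign_at hsep (by omega) hgn (j₀ := T - 1) (r := 1) (x₀ := 1) (xl := 0) (by omega) (Or.inl rfl) h (by omega)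
        (by omega) (by rw [e1, e2]; omega)
    · exact livenessDesign_at hsep (by omega) hgn (j₀ := T - 1) (r := 2) (x₀ := 0) (xl := 1) (by omega) (Or.inr rfl) (by omega)
        (by omega) h (by rw [e1, e2]; omega)
    · exact absurd hE h
  · exact livenessDesign_at hsep (by omega) hgn (j₀ := T - 1) (r := 2) (x₀ := 0) (xl := 0) (by omega) (Or.inr rfl) (by omega)
      (by omega) (by omega) (by rw [e1, e2]; omega)
  · exact livenessDesign_at hsep (by omega) hgn (j₀ := T - 1) (r := 1) (x₀ := 0) (xl := 0) (by omega) (Or.inl rfl) (by omega)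
      (by omega) (by omega) (by rw [e1, e2]; omega)

/-- A MIDDLE CUT ALONE (`0 < j`, `j + 1 < T`): possible when `E = c + 2 g₀ + 2 g_{T-1} ≡ 0`, or with end capacity (two free positions before the
first cut, or two after the last, or one on each side). -/
theorem isolate_middle (hsep : ∀ j, j + 1 < T → g j + 2 ≤ g (j + 1)) (hgn : g (T - 1) ≤ n) (c : ℕ) {j : ℕ} (hj0 : 0 < j)
    (hjT : j + 1 < T)
    (h : (c + 2 * g 0 + 2 * g (T - 1)) % 3 = 0 ∨ 2 ≤ g 0 ∨ g (T - 1) + 2 ≤ n ∨ (1 ≤ g 0 ∧ g (T - 1) + 1 ≤ n)) :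
    ∃ u : Fin n → Bool, (∀ gl : Fin (n + 1), gl.val = g j → liveCut c u gl = true) ∧
      ∀ l < T, l ≠ j → ∀ gl : Fin (n + 1), gl.val = g l → liveCut c u gl = false := by
  have e1 : tgt j 1 (T - 1) = 0 := tgt_of_ne 1 (by omega)
  have e2 : tgt j 1 0 = 0 := tgt_of_ne 1 (by omega)
  have hE : (c + 2 * g 0 + 2 * g (T - 1)) % 3 = 0 ∨ (c + 2 * g 0 + 2 * g (T - 1)) % 3 = 1 ∨
      (c + 2 * g 0 + 2 * g (T - 1)) % 3 = 2 := by omega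
  rcases h with h | h | h | h
  · exact livenessDesign_at hsep (by omega) hgn (j₀ := j) (r := 1) (x₀ := 0) (xl := 0) (by omega) (Or.inl rfl) (by omega) (by omega)
      (by omega) (by rw [e1, e2]; omega)
  · exact livenessDesign_at hsep (by omega) hgn (j₀ := j) (r := 1) (x₀ := (c + 2 * g 0 + 2 * g (T - 1)) % 3) (xl := 0) (by omega)
      (Or.inl rfl) (by omega) (by omega) (by omega) (by rw [e1, e2]; omega)
  · exact livenessDesign_at hsep (by omega) hgn (j₀ := j) (r := 1) (x₀ := 0) (xl := (2 * (c + 2 * g 0 + 2 * g (T - 1))) % 3) (by omega)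
      (Or.inl rfl) (by omega) (by omega) (by omega) (by rw [e1, e2]; omega)
  · rcases hE with hE | hE | hE
    · exact livenessDesign_at hsep (by omega) hgn (j₀ := j) (r := 1) (x₀ := 0) (xl := 0) (by omega) (Or.inl rfl) (by omega) (by omega)
        (by omega) (by rw [e1, e2]; omega)
    · exact livenessDesign_at hsep (by omega) hgn (j₀ := j) (r := 1) (x₀ := 1) (xl := 0) (by omega) (Or.inl rfl) (by omega) (by omega)
        (by omega) (by rw [e1, e2]; omega)
    · exact livenessDesign_at hsep (by omega) hgn (j₀ := j) (r := 1) (x₀ := 0) (xl := 1) (by omega) (Or.inl rfl) (by omega) (by omega)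
        (by omega) (by rw [e1, e2]; omega)

/-- two residue targets: `r₁` at cut `j₁`, `r₂` at cut `j₂ ≠ j₁`, `0` elsewhere -/
def tgt₂ (j₁ r₁ j₂ r₂ l : ℕ) : ℕ := if l = j₁ then r₁ else if l = j₂ then r₂ else 0

/-- two targets are residues -/
theorem tgt₂_le {j₁ r₁ j₂ r₂ : ℕ} (h₁ : r₁ ≤ 2) (h₂ : r₂ ≤ 2) (l : ℕ) : tgt₂ j₁ r₁ j₂ r₂ l ≤ 2 := by
  unfold tgt₂
  split_ifs <;> omega

/-- the first target -/
theorem tgt₂_fst (j₁ r₁ j₂ r₂ : ℕ) : tgt₂ j₁ r₁ j₂ r₂ j₁ = r₁ := by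
  unfold tgt₂
  rw [if_pos rfl]

/-- the second target -/
theorem tgt₂_snd {j₁ j₂ : ℕ} (r₁ r₂ : ℕ) (h : j₂ ≠ j₁) : tgt₂ j₁ r₁ j₂ r₂ j₂ = r₂ := by
  unfold tgt₂
  rw [if_neg h, if_pos rfl]

/-- away from both targets -/
theorem tgt₂_of_ne {j₁ j₂ l : ℕ} (r₁ r₂ : ℕ) (h₁ : l ≠ j₁) (h₂ : l ≠ j₂) : tgt₂ j₁ r₁ j₂ r₂ l = 0 := by
  unfold tgt₂
  rw [if_neg h₁, if_neg h₂]

/-- A MIDDLE CUT WITH AT MOST THE LAST CUT (`0 < j`, `j + 1 < T`) — ALWAYS: some input makes cut `j` live and every cut other than `j` and the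
last one dead (the last cut's liveness is dictated by `E`). -/
theorem isolate_middle_last (hsep : ∀ j, j + 1 < T → g j + 2 ≤ g (j + 1)) (hgn : g (T - 1) ≤ n) (c : ℕ) {j : ℕ} (hj0 : 0 < j)
    (hjT : j + 1 < T) :
    ∃ u : Fin n → Bool, (∀ gl : Fin (n + 1), gl.val = g j → liveCut c u gl = true) ∧
      ∀ l < T, l ≠ j → l ≠ T - 1 → ∀ gl : Fin (n + 1), gl.val = g l → liveCut c u gl = false := by
  set b := (2 * (c + 2 * g 0 + 2 * g (T - 1))) % 3 with hb
  have hR : ∀ l, tgt₂ j 1 (T - 1) b l ≤ 2 := tgt₂_le (by omega) (by omega)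
  have e1 : tgt₂ j 1 (T - 1) b (T - 1) = b := tgt₂_snd 1 b (by omega)
  have e2 : tgt₂ j 1 (T - 1) b 0 = 0 := tgt₂_of_ne 1 b (by omega) (by omega)
  obtain ⟨u, hu⟩ := livenessPattern (n := n) hsep (by omega) hgn (c := c) (x₀ := 0) (xl := 0) hR (by omega) (by omega) (by omega)
    (by rw [e1, e2]; omega)
  refine ⟨u, fun gl hgl => ?_, fun l hl hlj hlT gl hgl => ?_⟩
  · rw [hu j (by omega) gl hgl, tgt₂_fst]
    exact decide_eq_true (by omega)
  · rw [hu l hl gl hgl, tgt₂_of_ne 1 b hlj hlT]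
    exact decide_eq_false (by omega)

/-- A MIDDLE CUT WITH AT MOST THE FIRST CUT (`0 < j`, `j + 1 < T`) — ALWAYS. -/
theorem isolate_middle_first (hsep : ∀ j, j + 1 < T → g j + 2 ≤ g (j + 1)) (hgn : g (T - 1) ≤ n) (c : ℕ) {j : ℕ} (hj0 : 0 < j)
    (hjT : j + 1 < T) :
    ∃ u : Fin n → Bool, (∀ gl : Fin (n + 1), gl.val = g j → liveCut c u gl = true) ∧
      ∀ l < T, l ≠ j → l ≠ 0 → ∀ gl : Fin (n + 1), gl.val = g l → liveCut c u gl = false := by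
  set a := (2 * (c + 2 * g 0 + 2 * g (T - 1))) % 3 with ha
  have hR : ∀ l, tgt₂ j 1 0 a l ≤ 2 := tgt₂_le (by omega) (by omega)
  have e1 : tgt₂ j 1 0 a (T - 1) = 0 := tgt₂_of_ne 1 a (by omega) (by omega)
  have e2 : tgt₂ j 1 0 a 0 = a := tgt₂_snd 1 a (by omega)
  obtain ⟨u, hu⟩ := livenessPattern (n := n) hsep (by omega) hgn (c := c) (x₀ := 0) (xl := 0) hR (by omega) (by omega) (by omega)
    (by rw [e1, e2]; omega)
  refine ⟨u, fun gl hgl => ?_, fun l hl hlj hl0 gl hgl => ?_⟩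
  · rw [hu j (by omega) gl hgl, tgt₂_fst]
    exact decide_eq_true (by omega)
  · rw [hu l hl gl hgl, tgt₂_of_ne 1 a hlj hl0]
    exact decide_eq_false (by omega)

/-- BOTH END CUTS, EVERY MIDDLE CUT DEAD (`T ≥ 2`) — ALWAYS (the class used for the ends pair). -/
theorem isolate_ends (hsep : ∀ j, j + 1 < T → g j + 2 ≤ g (j + 1)) (hT : 2 ≤ T) (hgn : g (T - 1) ≤ n) (c : ℕ) :
    ∃ u : Fin n → Bool, (∀ gl : Fin (n + 1), gl.val = g 0 → liveCut c u gl = true) ∧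
      (∀ gl : Fin (n + 1), gl.val = g (T - 1) → liveCut c u gl = true) ∧
      ∀ l < T, l ≠ 0 → l ≠ T - 1 → ∀ gl : Fin (n + 1), gl.val = g l → liveCut c u gl = false := by
  have hE : (c + 2 * g 0 + 2 * g (T - 1)) % 3 = 0 ∨ (c + 2 * g 0 + 2 * g (T - 1)) % 3 = 1 ∨
      (c + 2 * g 0 + 2 * g (T - 1)) % 3 = 2 := by omega
  have key : ∀ a b : ℕ, (a = 1 ∨ a = 2) → (b = 1 ∨ b = 2) →
      (c + 2 * 0 + 0 + 2 * g 0 + 2 * g (T - 1) + b + 2 * (3 - a)) % 3 = 0 →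
      ∃ u : Fin n → Bool, (∀ gl : Fin (n + 1), gl.val = g 0 → liveCut c u gl = true) ∧
        (∀ gl : Fin (n + 1), gl.val = g (T - 1) → liveCut c u gl = true) ∧
        ∀ l < T, l ≠ 0 → l ≠ T - 1 → ∀ gl : Fin (n + 1), gl.val = g l → liveCut c u gl = false := by
    intro a b ha hb hab
    have hR : ∀ l, tgt₂ 0 a (T - 1) b l ≤ 2 := tgt₂_le (by omega) (by omega)
    have e1 : tgt₂ 0 a (T - 1) b (T - 1) = b := tgt₂_snd a b (by omega)
    have e2 : tgt₂ 0 a (T - 1) b 0 = a := tgt₂_fst 0 a (T - 1) b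
    obtain ⟨u, hu⟩ := livenessPattern (n := n) hsep (by omega) hgn (c := c) (x₀ := 0) (xl := 0) hR (by omega) (by omega) (by omega)
      (by rw [e1, e2]; exact hab)
    refine ⟨u, fun gl hgl => ?_, fun gl hgl => ?_, fun l hl hl0 hlT gl hgl => ?_⟩
    · rw [hu 0 (by omega) gl hgl, e2]
      exact decide_eq_true (by omega)
    · rw [hu (T - 1) (by omega) gl hgl, e1]
      exact decide_eq_true (by omega)
    · rw [hu l hl gl hgl, tgt₂_of_ne a b hl0 hlT]
      exact decide_eq_false (by omega)
  rcases hE with hE | hE | hE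
  · exact key 1 2 (Or.inl rfl) (Or.inr rfl) (by omega)
  · exact key 1 1 (Or.inl rfl) (Or.inl rfl) (by omega)
  · exact key 2 2 (Or.inr rfl) (Or.inr rfl) (by omega)

end Corollaries

/-! ### scattered one-sided free sets (the class bookkeeping of the sequential form, §5h (6)) -/

section Scattered

variable {m : ℕ}

/-- scattered free set right of (or at) the cut: every free coordinate weighs `1` (part E's `walkExp_fill_block_right` without the interval) -/
theorem walkExp_fill_right_of (ρ : Fin n → Bool) (T : Fin m ↪ Fin n) (g : ℕ) (hT : ∀ j, g ≤ (T j).val) (v : Fin m → Bool) :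
    walkExp (fill ρ T v) g = frozenExp ρ T g + (univ.filter fun j => v j = true).card := by
  rw [walkExp_fill, card_eq_sum_ones, sum_filter]
  congr 1
  refine sum_congr rfl fun j _ => ?_
  rw [ww_eq_one (hT j)]

/-- scattered free set left of the cut: every free coordinate weighs `2` -/
theorem walkExp_fill_left_of (ρ : Fin n → Bool) (T : Fin m ↪ Fin n) (g : ℕ) (hT : ∀ j, (T j).val < g) (v : Fin m → Bool) :
    walkExp (fill ρ T v) g = frozenExp ρ T g + 2 * (univ.filter fun j => v j = true).card := by
  rw [walkExp_fill, card_eq_sum_ones, mul_sum, sum_filter]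
  congr 1
  refine sum_congr rfl fun j _ => ?_
  rw [ww_eq_two (hT j)]
  split_ifs <;> simp

/-- ONE-SIDED SCATTERED FREE SETS: if every free coordinate lies on one side of cut `g`, the liveness of `g` on the subcube depends only on the number of
free ones mod 3 (part J's `liveCut_fill_block_outside` without the interval hypothesis — the form needed when frozen coordinates sit inside the gap block). -/
theorem liveCut_fill_oneSided (c : ℕ) (ρ : Fin n → Bool) (T : Fin m ↪ Fin n) (g : Fin (n + 1))
    (hT : (∀ j, g.val ≤ (T j).val) ∨ ∀ j, (T j).val < g.val) (v v' : Fin m → Bool)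
    (hvv : (univ.filter fun j => v j = true).card % 3 = (univ.filter fun j => v' j = true).card % 3) :
    liveCut c (fill ρ T v) g = liveCut c (fill ρ T v') g := by
  unfold liveCut
  rcases hT with hT | hT
  · rw [walkExp_fill_right_of ρ T g.val hT v, walkExp_fill_right_of ρ T g.val hT v']
    have : (c + g.val + (frozenExp ρ T g.val + (univ.filter fun j => v j = true).card)) % 3
        = (c + g.val + (frozenExp ρ T g.val + (univ.filter fun j => v' j = true).card)) % 3 := by omega
    rw [this]
  · rw [walkExp_fill_left_of ρ T g.val hT v, walkExp_fill_left_of ρ T g.val hT v']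
    have : (c + g.val + (frozenExp ρ T g.val + 2 * (univ.filter fun j => v j = true).card)) % 3
        = (c + g.val + (frozenExp ρ T g.val + 2 * (univ.filter fun j => v' j = true).card)) % 3 := by omega
    rw [this]

end Scattered

end Summit.QuantumAdvantage.QuantumAdvantage.Theorems.LivenessSeparation
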